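import Literature.Algebra.Polynomial.CasasAlvero.ClassificationSummary
import Literature.Algebra.Polynomial.CasasAlvero.CharSixtySevenComplete
import Literature.Algebra.Polynomial.CasasAlvero.CharSeventyOneComplete
import Literature.Algebra.Polynomial.CasasAlvero.CharSeventyThreeComplete
import HarnessLib

/-!
# Casas-Alvero degrees in every prime characteristic `p ≤ 73`: the complete classification, one statement

Extends `ClassificationSummary.lean` (`classification_of_char_le_61`) by the three primes `67, 71, 73` — the first beyond the
published / in-tree bad-prime tables of degrees `6` and `7` ([CastryckLaterveerOunaies2012, Thm. 4] lists the bad primes for `d ≤ 7`;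
the tree holds them for `p ≤ 47` resp. `p ≤ 61`), where the digits `6` and `7` are decided directly: `67`, `73` are BAD for degree `6`
and `71` is GOOD (it divides none of the certificate integers of `Degree6.lean`), and `67, 71, 73` are bad for degree `7`, by explicit
`𝔽_p`-rational sparse examples (`Char67Digits`, `Char71Digits`, `Char73Digits`, `Pentanomial`).  For EVERY prime `p ≤ 73` and EVERY
field `K` of characteristic `p`:

  `CA_d(K) ⟺ d = 0 ∨ d = a·p^k` with `1 ≤ a ≤ N(p)`,

`N(2) = 1`, `N(3) = 2`, `N(5) = N(7) = 3`, `N(11) = 4`, `N(p) = 6` for `p ∈ {17, 31, 41, 43, 53, 59, 71}` (the good primes for degree `6`) and `N(p) = 5` for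
`p ∈ {13, 19, 23, 29, 37, 47, 61, 67, 73}`.  No `sorry`, no new axioms; every case is a landed per-characteristic classification.
-/

noncomputable section

open Polynomial

namespace Literature.Algebra.Polynomial.CasasAlvero

variable (K : Type*) [Field K]

/-- **Casas-Alvero degrees in every prime characteristic `p ≤ 73`, completely**: over every field of characteristic `p`,
`CA_d ⟺ d = 0 ∨ d = a·p^k` with `1 ≤ a ≤ N(p)`; `N(2) = 1`, `N(3) = 2`, `N(5) = N(7) = 3`, `N(11) = 4`, `N(p) = 6` for `p = 17, 31, 41, 43, 53, 59, 71`,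
and `N(p) = 5` for `p = 13, 19, 23, 29, 37, 47, 61, 67, 73`. [cite: GrafVonBothmerEtAl2007, Props. 2, 5, 6, 7] [cite: CastryckLaterveerOunaies2012, Thm. 4] -/
theorem classification_of_char_le_73 (p : ℕ) [CharP K p]
    (hp : p ∈ ({2, 3, 5, 7, 11, 13, 17, 19, 23, 29, 31, 37, 41, 43, 47, 53, 59, 61, 67, 71, 73} : Finset ℕ)) (d : ℕ) :
    HoldsInDegree K d ↔ d = 0 ∨ ∃ k a : ℕ, 0 < a ∧
      a ≤ (if p = 2 then 1 else if p = 3 then 2 else if p ≤ 7 then 3 else if p = 11 then 4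
           else if p = 17 ∨ p = 31 ∨ p = 41 ∨ p = 43 ∨ p = 53 ∨ p = 59 ∨ p = 71 then 6 else 5) ∧ d = a * p ^ k := by
  simp only [Finset.mem_insert, Finset.mem_singleton] at hp
  rcases hp with rfl | rfl | rfl | rfl | rfl | rfl | rfl | rfl | rfl | rfl | rfl | rfl | rfl | rfl | rfl | rfl | rfl | rfl | rfl | rfl | rfl
  · simpa using (classification_char_two K d).trans (or_congr_right digitForm_one)
  · simpa using (classification_char_three K d).trans (or_congr_right digitForm_two)
  · simpa using (classification_char_five K d).trans (or_congr_right digitForm_three)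
  · simpa using (classification_char_seven K d).trans (or_congr_right digitForm_three)
  · simpa using (classification_char_eleven_complete K d).trans (or_congr_right digitForm_four)
  · simpa using classification_char_thirteen_complete K d
  · simpa using classification_char_seventeen_complete K d
  · simpa using classification_char_nineteen_complete K d
  · simpa using classification_char_twentyThree_complete K d
  · simpa using classification_char_twentyNine_complete K d
  · simpa using classification_char_thirtyOne_complete K d
  · simpa using classification_char_thirtySeven_complete K d
  · simpa using classification_char_fortyOne_complete K d
  · simpa using classification_char_fortyThree_complete K d
  · simpa using classification_char_fortySeven_complete K d
  · simpa using classification_char_fiftyThree_complete K d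
  · simpa using classification_char_fiftyNine_complete K d
  · simpa using classification_char_sixtyOne_complete K d
  · simpa using classification_char_sixtySeven_complete K d
  · simpa using classification_char_seventyOne_complete K d
  · simpa using classification_char_seventyThree_complete K d

/-- the primes `p ≤ 73` all qualify: the hypothesis of `classification_of_char_le_73` from `p.Prime ∧ p ≤ 73`.
[cite: CastryckLaterveerOunaies2012, Thm. 4] -/
theorem mem_primes_le_73 {p : ℕ} (hp : p.Prime) (h73 : p ≤ 73) :
    p ∈ ({2, 3, 5, 7, 11, 13, 17, 19, 23, 29, 31, 37, 41, 43, 47, 53, 59, 61, 67, 71, 73} : Finset ℕ) := by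
  interval_cases p <;> first | decide | exact absurd hp (by decide)

end Literature.Algebra.Polynomial.CasasAlvero
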